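/-
Copyright (c) 2026 the pub-hodgecm-mathlib formalisation cell (harness21).  Prover seat hodgecm-mathlib-K2E1-p11 (g5), Track B ∕ K2-LIT, h413 = `stmt-HodgeConjecture-24833`,
R90-TF section S8 «ContSpec-n½», ESTATE T (K-finite sections), S8 dealer R90-CS-plan (g3) RULING J-S8-T2 (S8-R208) — THE HEAD OF ESTATE T FILE 2, HYPOTHESIS-FIRST ON THE GAUGE LETTERS:
the row-8 `χ`-Eisenstein exports WITH BOUND at a K-FINITE BLOCK `V` (any finite-dimensional `K_max`-stable space of continuous bounded `(χ₁, χ₂)`-pair-sections), columns and scattering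
coordinates from ★ (b′) `K2E1ChiScatteringCoordsKFiniteCMThree`, the per-ball action bundle from ★ row 1 `exists_chi_convData_cm_three` at `V` — so the ONLY visible letters are row 1's
`hfam` ∕ `hnc` AT `V` (paid for 1-dimensional `ω` by ★ 7b-1, for `IsArchEigen` blocks by the τ-ports K2E1-p15 (g4) ∕ K2E2-p12 (g10) over ★ (α) p864279).
-/
import Summits.HodgeConjecture.HodgeConjecture.Theorems.K2E1ChiEisensteinMeromorphicExportsWithBoundCMThree   -- ★ p863590 (K2E1-p15): row 6 EIGEN head WITH (E2-bd), index-free over a bare `V : Submodule`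
import Summits.HodgeConjecture.HodgeConjecture.Theorems.K2E1ChiConvDataCMThree                              -- ★ row 1 (K2E1-p16): `exists_chi_convData_cm_three (V) (hfam) (hnc) n` = the per-ball bundle `hCD n`
import Summits.HodgeConjecture.HodgeConjecture.Theorems.K2E1ChiScatteringCoordsKFiniteCMThree                 -- ★ p864311 (this seat) (b′): `exists_kfinite_scatteringCoords_cm_three` (columns + `q hq hqφ` at a K-finite block)
import HarnessLib

/-!
# S8 ESTATE T FILE 2 (head, hypothesis-first) — `K2E1ChiEisensteinMeromorphicExportsKFiniteCMThree`: THE `χ`-EISENSTEIN EXPORTS WITH BOUND AT A K-FINITE BLOCK `V` —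
# ★ row 6 EIGEN-with-bound ∘ ★ (b′) K-finite columns ∘ ★ row 1 at `V`, modulo row 1's gauge letters `hfam` ∕ `hnc` AT `V`

Track B ∕ K2-LIT, crux h413 = `stmt-HodgeConjecture-24833`, route of record `HCCMUnconditional`; cell `hodgecm-mathlib`, R90-TF programme, section S8 «ContSpec-n½», ESTATE T (S8-R199∕R204∕R208;
plan of record = census `R90/S8/CENSUS-T-FILE2-KFiniteExports.K2E1-p11-g5.md` cc10c33dbec127a5, RULING J-S8-T2).  THEOREMS ONLY (no `def`, no `instance`, no `notation`, no named-fact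
hypothesis, no `sorry`; default heartbeats); lane `--supports stmt-HodgeConjecture-24833 --as helper` (count-neutral).  CLOSES NO SOCKET.

WHAT THIS HEAD DOES.  ★ `chiEisenstein_meromorphic_exports_cm_three_of_letters_of_eigen_with_bound` is index-free over a bare `V : Submodule`; its inputs beyond the frame are (i) the
section `φ ∈ V` continuous bounded `(χ₁,χ₂)`-pair-section, (ii) COLUMNS `φ' hli hφ'c hφ'χ hφ'M` and SCATTERING COORDINATES `q hq hqφ`, (iii) the per-ball action bundle `hCD`.  At a
K-FINITE BLOCK — `V` finite-dimensional, `K_max`-STABLE, made of continuous bounded `(χ₁, χ₂)`-pair-sections, `χ₂` automorphic — (i) is `φ ∈ V`, (ii) is ★ (b′)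
`exists_kfinite_scatteringCoords_cm_three` (matrix coefficients; columns `Fin n`), and (iii) is ★ row 1 `exists_chi_convData_cm_three L μ νG hβ hμZ V hfam hnc n` — leaving EXACTLY row 1's
two gauge letters AT `V` visible: `hfam` (for every `z₀` a symmetric non-negative test function whose self-convolution acts on `V ⊗ H^z` by an entire scalar non-vanishing at `z₀`) and `hnc`
(one with a non-constant scalar).  For `V = chiSectionSpace χ K′ ω` these are ★ 7b-1 `hfam_gauge_cm_three` ∕ `hnc_gauge_cm_three`; for an `IsArchEigen` block they are the τ-ports over ★ (α)
`R90S8KTypeSliceLineU3` (K2E1-p15 (g4) `K2E1ChiHeckeArchScalarTauU2`, K2E2-p12 (g10) `K2E1ChiGaugeSymbolTauCMThree`) — the letters below are row 1's BYTES, so those heads plug in by name.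
* HEAD **`chiEisenstein_meromorphic_exports_kfinite_cm_three_of_gauge_letters`** — conclusion: `∃ n φ' q Ec qc P`, the columns' four properties, `hq`, `hqφ`, then ★ with-bound's clause list
  VERBATIM ((E1) normal forms, tube identity, `qc = q` on `{2 < Re}`, closed co-discrete pole set `P ⊆ {Re ≤ 2}`, analyticity ∕ holomorphy off `P`, (E4) continuity, (E2-bd) joint local bound).
HONEST LABEL: HC_CM is proved only modulo the 7 printed citations (2 remaining named inputs: hLiu418 = `stmt-HodgeConjecture-24832`, h413 = `stmt-HodgeConjecture-24833`) until rung 0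
closes; REL ≠ ★ ≠ BUILT; this head is CONDITIONAL BY CONSTRUCTION on the visible letters `hfam` ∕ `hnc` at `V` and closes no socket; ESTATE T stays L until the τ-ports land and this head
is instantiated at the `IsArchEigen` blocks; count-neutral.

## References
* [BernsteinLapid2019] J. Bernstein, E. Lapid, *On the meromorphic continuation of Eisenstein series*, J. Amer. Math. Soc. 37 (2024), Thm 2.3, §4, §7.
* [MoeglinWaldspurger1995] C. Mœglin, J.-L. Waldspurger, *Spectral Decomposition and Eisenstein Series* (1995), II.1.7, IV.1.8–IV.1.11.
* [Bump1997] D. Bump, *Automorphic Forms and Representations* (1997), proof of Lemma 2.3.2.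
-/

set_option autoImplicit false
set_option linter.dupNamespace false  -- the mandated namespace repeats the summit's segment (`HodgeConjecture.HodgeConjecture`)

noncomputable section

open MeasureTheory Measure Filter Topology Set NumberField IsDedekindDomain
open scoped NNReal ENNReal ComplexConjugate
open Literature.MeasureTheory.Group Literature.NumberTheory Literature.NumberTheory.Automorphic Literature.NumberTheory.Automorphic.UnitaryGroup AdelicGroupData
open Literature.NumberTheory.Automorphic.Arthur2013.Leaves.TECR
open Literature.NumberTheory.GaloisRepresentations (HeckeCharacter)
open Summit.HodgeConjecture.HodgeConjecture.Cruxes.H413.K2E1BorelEisensteinU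
open Summit.HodgeConjecture.HodgeConjecture.Cruxes.H413.K2E1BLBorelSpacesU2Defs
open Summit.HodgeConjecture.HodgeConjecture.Cruxes.H413.K2E1BLBorelOperatorsU2Defs
open Summit.HodgeConjecture.HodgeConjecture.Cruxes.H413.K2E1CharacterEisensteinU2Defs
open Summit.HodgeConjecture.HodgeConjecture.Cruxes.H413.K2E1BLIotaClosedEmbeddingU3 (iotaBound_cm_three)
open Summit.HodgeConjecture.HodgeConjecture.Cruxes.H413.K2E1CharacterEisensteinU3PairDefs (IsChiSectionPair)
open Summit.HodgeConjecture.HodgeConjecture.Cruxes.H413.K2E1ChiEisensteinMeromorphicExportsWithBoundCMThree (chiEisenstein_meromorphic_exports_cm_three_of_letters_of_eigen_with_bound)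
open Summit.HodgeConjecture.HodgeConjecture.Cruxes.H413.K2E1ChiConvDataCMThree (exists_chi_convData_cm_three)
open Summit.HodgeConjecture.HodgeConjecture.Cruxes.H413.K2E1ChiScatteringCoordsKFiniteCMThree (exists_kfinite_scatteringCoords_cm_three)

namespace Summit.HodgeConjecture.HodgeConjecture.Cruxes.H413.K2E1ChiEisensteinMeromorphicExportsKFiniteCMThree

variable (L : Type) [Field L] [NumberField L] [IsCMField L]
  [MeasurableSpace (quasiSplit (↥(maximalRealSubfield L)) L (IsCMField.complexConj L) 3).Adelic] [BorelSpace (quasiSplit (↥(maximalRealSubfield L)) L (IsCMField.complexConj L) 3).Adelic]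

/-- **THE `χ`-EISENSTEIN EXPORTS WITH BOUND AT A K-FINITE BLOCK, MODULO THE GAUGE LETTERS AT `V`** (ESTATE T FILE 2 head, RULING J-S8-T2): for `χ₂` automorphic, `V` a finite-dimensional
`K_max`-stable submodule of continuous bounded `(χ₁, χ₂)`-pair-sections, the gauge letters `hfam` ∕ `hnc` of ★ row 1 AT `V`, and `φ ∈ V`: columns `φ' : Fin n → G(𝔸) → ℂ` (linearly independent
continuous uniformly bounded `(χ₁ʷ, χ₂)`-pair-sections, ★ (b′)), scattering coordinates `q` holomorphic on `{2 < Re}` with `Σ q_j φ'_j = (ν𝓕)⁻¹·φ̃_z`, and the continued family `Ec`,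
continued coordinates `qc`, ONE closed co-discrete pole set `P ⊆ {Re ≤ 2}` with (E1)–(E4) and (E2-bd) — ★ with-bound's clause list verbatim.
[cite: BernsteinLapid2019, Thm 2.3, §4, §7] [cite: MoeglinWaldspurger1995, II.1.7, IV.1.8–IV.1.11] [cite: Bump1997, proof of Lemma 2.3.2] -/
theorem chiEisenstein_meromorphic_exports_kfinite_cm_three_of_gauge_letters
    (μ : Measure (quasiSplit (↥(maximalRealSubfield L)) L (IsCMField.complexConj L) 3).automorphicQuotient) [(quasiSplit (↥(maximalRealSubfield L)) L (IsCMField.complexConj L) 3).IsAutomorphicMeasure μ]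
    (νG : Measure (quasiSplit (↥(maximalRealSubfield L)) L (IsCMField.complexConj L) 3).Adelic) [νG.IsHaarMeasure] [νG.IsInvInvariant] [SFinite νG]
    (ν : Measure ↥(adelicUnipotent (↥(maximalRealSubfield L)) L (IsCMField.complexConj L) 3)) [ν.IsHaarMeasure] [ν.IsMulRightInvariant] [ν.IsInvInvariant]
    {𝓕 : Set ↥(adelicUnipotent (↥(maximalRealSubfield L)) L (IsCMField.complexConj L) 3)}
    (h𝓕N : IsFundamentalDomain ↥(rationalUnipotent (↥(maximalRealSubfield L)) L (IsCMField.complexConj L) 3) 𝓕 ν) (h𝓕c : IsCompact (closure 𝓕)) (h𝓕₀ : ν 𝓕 ≠ 0)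
    {β : (quasiSplit (↥(maximalRealSubfield L)) L (IsCMField.complexConj L) 3).Adelic → ℝ≥0∞}
    (hβ : IsCoveringWeight ↥((arithmeticBorel (↥(maximalRealSubfield L)) L (IsCMField.complexConj L) 3).map (quasiSplit (↥(maximalRealSubfield L)) L (IsCMField.complexConj L) 3).arithmeticSubgroup.subtype) β)
    {μZ : Measure (borelQuotient (↥(maximalRealSubfield L)) L (IsCMField.complexConj L) 3)} [SFinite μZ]
    (hμZ : ∀ f : borelQuotient (↥(maximalRealSubfield L)) L (IsCMField.complexConj L) 3 → ℝ≥0∞, Measurable f → ∫⁻ z, f z ∂μZ = ∫⁻ g, β g * f (toBorelQuotient (↥(maximalRealSubfield L)) L (IsCMField.complexConj L) 3 g) ∂νG)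
    -- the K-FINITE BLOCK: a finite-dimensional `K_max`-stable space of continuous bounded `(χ₁, χ₂)`-pair-sections, `χ₂` automorphic
    {χ₁ : HeckeCharacter L} {χ₂ : ↥(TorusDict.torus (IsCMField.complexConj L)) →ₜ* ℂˣ} (hχ₂ : TorusDict.IsAutomorphic (IsCMField.complexConj L) χ₂)
    (V : Submodule ℂ ((quasiSplit (↥(maximalRealSubfield L)) L (IsCMField.complexConj L) 3).Adelic → ℂ)) [FiniteDimensional ℂ ↥V]
    (hVK : ∀ k ∈ ((standardMaximalCompactGL 3 L).comap (adelicVal (↥(maximalRealSubfield L)) L (IsCMField.complexConj L) 3 ((StdForm.antidiagonal 3).over L)) : Subgroup (quasiSplit (↥(maximalRealSubfield L)) L (IsCMField.complexConj L) 3).Adelic), ∀ ψ ∈ V, (fun x => ψ (x * k)) ∈ V)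
    (hVχ : ∀ ψ ∈ V, IsChiSectionPair χ₁ χ₂ ψ) (hVc : ∀ ψ ∈ V, Continuous ψ) (hVM : ∀ ψ ∈ V, ∃ M : ℝ, ∀ x, ‖ψ x‖ ≤ M)
    -- THE VISIBLE LETTERS: row 1's gauge letters AT `V` (bytes of ★ `exists_chi_convData_cm_three`)
    (hfam : ∀ z₀ : ℂ, ∃ η : GL (Fin 3) (AdeleRing (𝓞 L) L) → ℝ, IsTestFunctionGL 3 L η ∧ (∀ g, 0 ≤ η g) ∧ (∀ g, η g⁻¹ = η g) ∧
      ∃ s : ℂ → ℂ, Differentiable ℂ s ∧ s z₀ ≠ 0 ∧ ∀ z : ℂ, ∀ φ ∈ V, ∀ x : (quasiSplit (↥(maximalRealSubfield L)) L (IsCMField.complexConj L) 3).Adelic, (∫ y, (fun y : (quasiSplit (↥(maximalRealSubfield L)) L (IsCMField.complexConj L) 3).Adelic => orbitalSmoothing νG (fun x : (quasiSplit (↥(maximalRealSubfield L)) L (IsCMField.complexConj L) 3).Adelic => ((η (adelicVal (↥(maximalRealSubfield L)) L (IsCMField.complexConj L) 3 ((StdForm.antidiagonal 3).over L) x) : ℝ)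 : ℂ)) (fun x : (quasiSplit (↥(maximalRealSubfield L)) L (IsCMField.complexConj L) 3).Adelic => ((η (adelicVal (↥(maximalRealSubfield L)) L (IsCMField.complexConj L) 3 ((StdForm.antidiagonal 3).over L) x) : ℝ) : ℂ)) y) y * flatSectionU φ z (x * y) ∂νG) = s z * flatSectionU φ z x)
    (hnc : ∃ η : GL (Fin 3) (AdeleRing (𝓞 L) L) → ℝ, IsTestFunctionGL 3 L η ∧ (∀ g, 0 ≤ η g) ∧ (∀ g, η g⁻¹ = η g) ∧
      ∃ s : ℂ → ℂ, Differentiable ℂ s ∧ (∃ z₁ z₂ : ℂ, s z₁ ≠ s z₂) ∧ ∀ z : ℂ, ∀ φ ∈ V, ∀ x : (quasiSplit (↥(maximalRealSubfield L)) L (IsCMField.complexConj L) 3).Adelic, (∫ y, (fun y : (quasiSplit (↥(maximalRealSubfield L)) L (IsCMField.complexConj L) 3).Adelic => orbitalSmoothing νG (fun x : (quasiSplit (↥(maximalRealSubfield L)) L (IsCMField.complexConj L) 3).Adelic => ((η (adelicVal (↥(maximalRealSubfield L)) L (IsCMField.complexConj L) 3 ((StdForm.antidiagonal 3).over L) x)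 : ℝ) : ℂ)) (fun x : (quasiSplit (↥(maximalRealSubfield L)) L (IsCMField.complexConj L) 3).Adelic => ((η (adelicVal (↥(maximalRealSubfield L)) L (IsCMField.complexConj L) 3 ((StdForm.antidiagonal 3).over L) x) : ℝ) : ℂ)) y) y * flatSectionU φ z (x * y) ∂νG) = s z * flatSectionU φ z x)
    {φ : (quasiSplit (↥(maximalRealSubfield L)) L (IsCMField.complexConj L) 3).Adelic → ℂ} (hφ : φ ∈ V) :
    ∃ (n : ℕ) (φ' : Fin n → (quasiSplit (↥(maximalRealSubfield L)) L (IsCMField.complexConj L) 3).Adelic → ℂ) (q : Fin n → ℂ → ℂ) (Ec : ℂ → (quasiSplit (↥(maximalRealSubfield L)) L (IsCMField.complexConj L) 3).Adelic → ℂ) (qc : Fin n → ℂ → ℂ) (P : Set ℂ),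
      -- the columns (★ (b′)) and the scattering coordinates (★ 7c)
      LinearIndependent ℂ φ' ∧ (∀ j, IsChiSectionPair (reflectChar (IsCMField.complexConj L) χ₁) χ₂ (φ' j)) ∧ (∀ j, Continuous (φ' j)) ∧ (∃ Mb : ℝ, ∀ j x, ‖φ' j x‖ ≤ Mb) ∧
      (∀ j, DifferentiableOn ℂ (q j) {z : ℂ | 2 < z.re}) ∧
      (∀ z : ℂ, 2 < z.re → (∑ j, q j z • φ' j) = ((((ν 𝓕).toReal⁻¹ : ℝ)) : ℂ) • (fun g : (quasiSplit (↥(maximalRealSubfield L)) L (IsCMField.complexConj L) 3).Adelic => (∫ v : ↥(adelicUnipotent (↥(maximalRealSubfield L)) L (IsCMField.complexConj L) 3), flatSectionU φ z ((quasiSplit (↥(maximalRealSubfield L)) L (IsCMField.complexConj L) 3).toAdelic (weylLongU ((IsCMField.complexConj L : L ≃ₐ[↥(maximalRealSubfield L)] L) : L →+* L) (rfl : (StdForm.antidiagonal 3).over L = (StdForm.antidiagonal 3).over L)) * ((v : (quasiSplit (↥(maximalRealSubfield L)) L (IsCMField.complexConj L) 3).Adelic) * g)) ∂ν) * (((borelHeight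 g : ℝ) : ℂ) ^ (z - 2)))) ∧
      -- ★ with-bound's clause list: (E1) normal forms, tube identity, `qc = q` on `{2 < Re}`, the pole set, analyticity ∕ holomorphy off `P`, (E4), (E2-bd)
      ((∀ g, MeromorphicNFOn (fun z => Ec z g) univ) ∧ (∀ j, MeromorphicNFOn (qc j) univ) ∧
      (∀ z : ℂ, 2 < z.re → Ec z = eisensteinSeriesU (flatSectionU φ z)) ∧ (∀ j (z : ℂ), 2 < z.re → qc j z = q j z) ∧
      IsClosed P ∧ (∀ z₀ : ℂ, ∀ᶠ s in 𝓝[≠] z₀, s ∉ P) ∧ (∀ z ∈ P, z.re ≤ 2) ∧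
      (∀ g (z : ℂ), z ∉ P → AnalyticAt ℂ (fun z => Ec z g) z) ∧ (∀ j (z : ℂ), z ∉ P → AnalyticAt ℂ (qc j) z) ∧
      (∀ g, DifferentiableOn ℂ (fun z => Ec z g) Pᶜ) ∧ (∀ j, DifferentiableOn ℂ (qc j) Pᶜ) ∧
      (∀ z : ℂ, z ∉ P → Continuous (Ec z)) ∧
      -- (E2-bd) THE JOINT LOCAL BOUND off `P`
      (∀ z₁ : ℂ, z₁ ∉ P → ∀ K : Set (quasiSplit (↥(maximalRealSubfield L)) L (IsCMField.complexConj L) 3).Adelic, IsCompact K → ∃ V ∈ 𝓝 z₁, ∃ M : ℝ, ∀ z ∈ V, ∀ g ∈ K, ‖Ec z g‖ ≤ M)) := by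
  classical
  obtain ⟨n, φ', q, hli, hχ', hc', ⟨Mb, hMb⟩, hq, hqφ⟩ := exists_kfinite_scatteringCoords_cm_three L ν h𝓕N h𝓕c hχ₂ V hVK hVχ hVc hVM hφ
  obtain ⟨Mφ, hφM⟩ := hVM φ hφ
  obtain ⟨Ec, qc, P, hE⟩ := chiEisenstein_meromorphic_exports_cm_three_of_letters_of_eigen_with_bound L μ νG ν h𝓕N h𝓕c h𝓕₀ hβ hμZ hχ₂ (hVχ φ hφ) hφ (hVc φ hφ) hφM hχ₂
    hli hc' hχ' hMb q hq hqφ fun n => exists_chi_convData_cm_three L μ νG hβ hμZ V hfam hnc n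
  exact ⟨n, φ', q, Ec, qc, P, hli, hχ', hc', ⟨Mb, hMb⟩, hq, hqφ, hE⟩

end Summit.HodgeConjecture.HodgeConjecture.Cruxes.H413.K2E1ChiEisensteinMeromorphicExportsKFiniteCMThree

end
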